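import Summits.QuantumAdvantage.QuantumAdvantage.Theorems.CubicForrelationNearExactIsExactKtHalfBase

/-!
# Crux `CubicForrelation.NearExactIsExact` (stmt-QuantumAdvantage-14043) — Kasami–Tokura at weight `1.5·d_min` for EVERY order, III:
  the structure theorem (a word of `RM(r,m)` with exactly `3·2^{m−r−1}` ones is `(A₀A₁ ⊕ A₂A₃) ∧ P₀ ∧ ⋯ ∧ P_{r−3}`, coordinate-free)

Certificate seat `b2b-cforr-cert` (gen 44).  HONEST FRAMING: a coding-theory BRICK (standard axioms, no `decide` on data, uniform in the number
of bits `m` AND in the order): the weight-`1.5·d_min` case of KASAMI–TOKURA's theorem (1970, Thm 1) — a Boolean function of degree `≤ s+2`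
with EXACTLY `3·2^{m−s−3}` ones is affinely equivalent to `x₁⋯x_s·(x_{s+1}x_{s+2} ⊕ x_{s+3}x_{s+4})` — stated in the tree's coordinate-free
bit-vector language: `e = (A₀A₁ ⊕ A₂A₃) ∧ ⋀ⱼ Pⱼ` with affine `Aᵢ` (`i < 4`), `Pⱼ` (`j < s`) that admit a DUAL FAMILY of translation vectors
(`vᵢ` flips exactly `Aᵢ`, `uⱼ` flips exactly `Pⱼ`, all other factors fixed — this is linear independence of the `s + 4` linear parts) and a
point of `{P = 1}`.  The tree had the classification only for `r = 3` (`kt3_structure`, `kt3_hyperplane_form`, gen 19); the present brick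
serves the three structure questions left open at `n = 14` (DISPROOF.md §18.3: the bent-side line `Φ = 29/32`, `f ⊕ g̃` of weight `768` in
`RM(5,14)`; §32.5 configuration T′: `#E = 1536` in `RM(4,14)`; §32.4 (L′b): `#P = 6144` in `RM(2,14)`).  NOT summit progress; no value of
`θ₁₄` is claimed.

THE INDUCTION (`kh_structure`, on `s`, for all `m` at once).  `s = 0`: Dickson (`kh_base`).  Step `s → s+1`, `e` of degree `≤ s+3` with
`2^{s+4}·#E = 3·2^m`:  (1) an affine hyperplane `{L = 1} ⊇ E` with a flipping vector `u` — for `s = 0` from the cubic structure theorem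
`kt3_structure` (the weight `6·2^{m−5}` is not the exceptional `7·2^{m−5}`), for `s ≥ 1` from the induction hypothesis applied to a
derivative `e ⊕ e(·⊕a)` with `2#E` ones (`kh_exists_double_derivative`; its support contains `E` because `E ∩ (E⊕a) = ∅`,
`kh_disjoint_of_card`) whose first prefix factor is the wanted `L`;  (2) `e = L ∧ D` with `D = e ⊕ e(·⊕u)` of degree `≤ s+2`, `u`-periodic,
`2#E` ones (`kh_hyperplane_form`);  (3) the induction hypothesis for `D` gives `(A, P)` with duals;  (4) `u`-periodicity of `D` makes every
`Aᵢ, Pⱼ` `u`-invariant (`kh_nf_invariant`), the duals are adjusted by `u` to fix `L` (`kh_dual_adjust`), and `(A; L, P)` with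
`(v; u, u_P)` is the normal form of order `s+1`.

* `kh_structure` (all `s`, `m`); corollaries `kh_structure_rm5_fourteen_768` (`RM(5,14)`, weight `768`), `kh_structure_rm4_fourteen_1536`
  (`RM(4,14)`, weight `1536`), `kh_structure_rm2_fourteen_6144` (`RM(2,14)`, weight `6144`) in the `Fin (7+7)` format of the `n = 14` files.

References: T. Kasami, N. Tokura, *On the weight structure of Reed–Muller codes*, IEEE Trans. IT 16 (1970) 752–759, Thm 1; F. J. MacWilliams,
N. J. A. Sloane (1977) Ch. 15 §3; C. Carlet (2021) §4.1 (p. 157).  Everything is proved from Mathlib and the tree; axioms: the standard three.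
-/

set_option linter.dupNamespace false -- D-0017: single-problem summit ⇒ `QuantumAdvantage.QuantumAdvantage` by design

noncomputable section

namespace Summit.QuantumAdvantage.QuantumAdvantage.Theorems.CubicForrelation.NearExactIsExact

open Finset
open Literature.Computability.QuantumComplexity
open Literature.Computability.QuantumComplexity.BuzetChailloux (bxor zeroVec bxor_self bxor_zeroVec zeroVec_bxor bxor_comm
  bxor_bxor_cancel_left)
open Literature.Computability.QuantumComplexity.DerivativeWalsh (twist_bxor_left)
open Summit.QuantumAdvantage.QuantumAdvantage.Theorems.SignedCubicForrelationNotPrBPP (knf_isDegLeFun_ip)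

/-- **Kasami–Tokura at weight `1.5·d_min`, every order (coordinate-free).**  Let `e : 𝔽₂^m → 𝔽₂` have degree `≤ s + 2` and exactly
`3·2^{m−s−3}` ones (`2^{s+3}·#{e = 1} = 3·2^m`).  Then there are affine `A₀,…,A₃` and `P₀,…,P_{s−1}`, vectors `v₀,…,v₃`, `u₀,…,u_{s−1}`
and a point `x₀` such that: `vᵢ` flips `Aᵢ` and fixes every other `A_k` and every `Pⱼ`; `uⱼ` flips `Pⱼ` and fixes every other `P_k` and
every `Aᵢ`; `Pⱼ(x₀) = 1` for all `j`; and `e(x) = (A₀(x)A₁(x) ⊕ A₂(x)A₃(x)) ∧ ⋀ⱼ Pⱼ(x)` for every `x`.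
[this work; cite: KasamiTokura1970, Thm 1] -/
theorem kh_structure (s : ℕ) : ∀ (m : ℕ) (e : (Fin m → Bool) → Bool), IsDegLeFun (s + 2) e →
    2 ^ (s + 3) * #(univ.filter fun x => e x = true) = 3 * 2 ^ m →
    ∃ (A : Fin 4 → (Fin m → Bool) → Bool) (P : Fin s → (Fin m → Bool) → Bool)
      (v : Fin 4 → Fin m → Bool) (u : Fin s → Fin m → Bool) (x₀ : Fin m → Bool),
      (∀ i, IsDegLeFun 1 (A i)) ∧ (∀ j, IsDegLeFun 1 (P j)) ∧
      (∀ i x, A i (bxor x (v i)) = !A i x) ∧ (∀ i k x, i ≠ k → A i (bxor x (v k)) = A i x) ∧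
      (∀ i k x, A i (bxor x (u k)) = A i x) ∧
      (∀ j k x, P j (bxor x (v k)) = P j x) ∧
      (∀ j x, P j (bxor x (u j)) = !P j x) ∧ (∀ j k x, j ≠ k → P j (bxor x (u k)) = P j x) ∧
      (∀ j, P j x₀ = true) ∧
      ∀ x, e x = (((A 0 x && A 1 x) ^^ (A 2 x && A 3 x)) && decide (∀ j, P j x = true)) := by
  classical
  induction s with
  | zero =>
    intro m e he hw
    obtain ⟨A, v, hA, hAv, hAv', hnf⟩ := kh_base e he (by simpa using hw)
    refine ⟨A, fun j => Fin.elim0 j, v, fun j => Fin.elim0 j, zeroVec, hA, fun j => Fin.elim0 j, hAv, hAv',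
      fun i k => Fin.elim0 k, fun j => Fin.elim0 j, fun j => Fin.elim0 j, fun j => Fin.elim0 j, fun j => Fin.elim0 j, fun x => ?_⟩
    rw [hnf x]
    have : decide (∀ j : Fin 0, (Fin.elim0 j : (Fin m → Bool) → Bool) x = true) = true := decide_eq_true fun j => Fin.elim0 j
    rw [this, Bool.and_true]
  | succ s ih =>
    intro m e he hw
    have hM : #(univ : Finset (Fin m → Bool)) = 2 ^ m := by
      rw [card_univ, Fintype.card_fun, Fintype.card_bool, Fintype.card_fin]
    have hMpos : 0 < 2 ^ m := by positivity
    set S := univ.filter (fun x : Fin m → Bool => e x = true) with hSdef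
    have hSpos : 0 < #S := by
      rcases Nat.eq_zero_or_pos #S with h0 | h0
      · rw [h0, mul_zero] at hw; omega
      · exact h0
    -- (1) an affine hyperplane `{L = 1}` containing the support, with a flipping vector `uL`
    obtain ⟨L, uL, hL1, hLu, hS⟩ : ∃ (L : (Fin m → Bool) → Bool) (uL : Fin m → Bool), IsDegLeFun 1 L ∧
        (∀ x, L (bxor x uL) = !L x) ∧ ∀ x, e x = true → L x = true := by
      rcases Nat.eq_zero_or_pos s with hs0 | hs1
      · -- cubic: the tree's structure theorem for `RM(3,m)` below `2d`
        subst hs0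
        have he3 : IsDegLeFun 3 e := he
        have h4 : 4 * #S < 2 ^ m := by omega
        rcases kt3_structure e he3 hSpos h4 with ⟨z, b, hz, hzb⟩ | hexc
        · set ℓ : (Fin m → Bool) → Bool := fun x => decide (Odd #(univ.filter fun i => (x i && z i) = true)) with hℓ
          have htw : ∀ x, twist x z = signOf (ℓ x) := fun x => vg_twist_eq_signOf x z
          obtain ⟨uL, huL⟩ := es_exists_twist_neg hz
          rw [twist_comm] at huL
          have hℓu : ∀ x, ℓ (bxor x uL) = !ℓ x := by
            intro x
            have h := twist_bxor_left x uL z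
            rw [htw, htw, huL] at h
            revert h; cases ℓ (bxor x uL) <;> cases ℓ x <;> norm_num [signOf]
          refine ⟨fun x => ℓ x ^^ !b, uL, tb_isDegLeFun_xor_const (knf_isDegLeFun_ip z) _, fun x => ?_, fun x hx => ?_⟩
          · show (ℓ (bxor x uL) ^^ !b) = !(ℓ x ^^ !b)
            rw [hℓu]; cases ℓ x <;> cases b <;> rfl
          · show (ℓ x ^^ !b) = true
            have := hzb x hx
            change ℓ x = b at this
            rw [this]; cases b <;> rfl
        · exfalso
          rw [← hSdef] at hexc
          omega
      · -- `s ≥ 1`: the first prefix factor of the normal form of a disjoint-translate derivative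
        obtain ⟨a, ha⟩ := kh_exists_double_derivative s e he hw
        have hdis := kh_disjoint_of_card e a ha
        have hwa : 2 ^ (s + 3) * #(univ.filter fun x => (e x ^^ e (bxor x a)) = true) = 3 * 2 ^ m := by
          rw [ha, ← hw, pow_succ]; ring
        obtain ⟨A', P', v', u', x₀', -, hP', -, -, -, -, hPu', -, -, hnf'⟩ :=
          ih m (fun x => e x ^^ e (bxor x a)) (stub_derivDegree m (s + 2) e a he) hwa
        refine ⟨P' ⟨0, hs1⟩, u' ⟨0, hs1⟩, hP' _, hPu' _, fun x hx => ?_⟩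
        have hD : (e x ^^ e (bxor x a)) = true := by rw [hx, hdis x hx]; rfl
        rw [hnf' x, Bool.and_eq_true] at hD
        exact (of_decide_eq_true hD.2) ⟨0, hs1⟩
    -- (2) `e = L ∧ D`, `D` the `uL`-derivative
    obtain ⟨hdegD, hper, hcardD, -, hfact⟩ := kh_hyperplane_form (d := s + 2) e he L uL hLu hS
    -- (3) the induction hypothesis for `D`
    have hwD : 2 ^ (s + 3) * #(univ.filter fun x => (e x ^^ e (bxor x uL)) = true) = 3 * 2 ^ m := by
      rw [hcardD, ← hw, pow_succ]; ring
    obtain ⟨A, P, v, u, x₀, hA, hP, hAv, hAv', hAu, hPv, hPu, hPu', hx₀, hnf⟩ := ih m _ hdegD hwD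
    -- (4) `uL` fixes every factor; adjust the duals to fix `L`
    have hinv := kh_nf_invariant A P v hA hP hAv hAv' hPv x₀ hx₀ uL (fun x => by rw [← hnf, ← hnf]; exact hper x)
    obtain ⟨hAuL, hPuL⟩ := hinv
    set F : (Fin 4 ⊕ Fin s) → (Fin m → Bool) → Bool := Sum.elim A P with hF
    have hFu : ∀ idx x, F idx (bxor x uL) = F idx x := by
      rintro (i | j) x
      · exact hAuL i x
      · exact hPuL j x
    have hadj : ∀ w : Fin m → Bool, ∃ w' : Fin m → Bool, (∀ x, L (bxor x w') = L x) ∧ ∀ idx x, F idx (bxor x w') = F idx (bxor x w) :=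
      fun w => kh_dual_adjust L hL1 uL hLu F hFu w
    choose adj hadjL hadjF using hadj
    have hadjA : ∀ w i x, A i (bxor x (adj w)) = A i (bxor x w) := fun w i x => hadjF w (Sum.inl i) x
    have hadjP : ∀ w j x, P j (bxor x (adj w)) = P j (bxor x w) := fun w j x => hadjF w (Sum.inr j) x
    -- the new base point
    obtain ⟨y₀, hy₀L, hy₀P⟩ : ∃ y₀, L y₀ = true ∧ ∀ j, P j y₀ = true := by
      cases hL0 : L x₀
      · exact ⟨bxor x₀ uL, by rw [hLu, hL0]; rfl, fun j => by rw [hPuL]; exact hx₀ j⟩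
      · exact ⟨x₀, hL0, hx₀⟩
    -- (5) assemble the normal form of order `s + 1`
    refine ⟨A, Fin.cons L P, fun i => adj (v i), Fin.cons uL (fun j => adj (u j)), y₀, hA, ?_, ?_, ?_, ?_, ?_, ?_, ?_, ?_, fun x => ?_⟩
    · refine Fin.cases ?_ (fun j => ?_)
      · simpa using hL1
      · simpa using hP j
    · intro i x
      rw [hadjA, hAv]
    · intro i k x hik
      rw [hadjA, hAv' i k x hik]
    · intro i
      refine Fin.cases (fun x => ?_) (fun k x => ?_)
      · simp only [Fin.cons_zero]; exact hAuL i x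
      · simp only [Fin.cons_succ]; rw [hadjA, hAu]
    · refine Fin.cases (fun k x => ?_) (fun j k x => ?_)
      · simp only [Fin.cons_zero]; exact hadjL _ x
      · simp only [Fin.cons_succ]; rw [hadjP, hPv]
    · refine Fin.cases (fun x => ?_) (fun j x => ?_)
      · simp only [Fin.cons_zero]; exact hLu x
      · simp only [Fin.cons_succ]; rw [hadjP, hPu]
    · refine Fin.cases ?_ (fun j => ?_)
      · refine Fin.cases (fun x h => absurd rfl h) (fun k x _ => ?_)
        simp only [Fin.cons_zero, Fin.cons_succ]; exact hadjL _ x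
      · refine Fin.cases (fun x _ => ?_) (fun k x hjk => ?_)
        · simp only [Fin.cons_zero, Fin.cons_succ]; exact hPuL j x
        · simp only [Fin.cons_succ]
          rw [hadjP, hPu' j k x (fun h => hjk (by rw [h]))]
    · refine Fin.cases ?_ (fun j => ?_)
      · simpa using hy₀L
      · simpa using hy₀P j
    · rw [hfact x, hnf x]
      have key : decide (∀ j : Fin (s + 1), (Fin.cons L P : Fin (s + 1) → (Fin m → Bool) → Bool) j x = true) =
          (L x && decide (∀ j : Fin s, P j x = true)) := by
        by_cases h1 : L x = true <;> by_cases h2 : (∀ j : Fin s, P j x = true) <;>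
          simp [Fin.forall_fin_succ, Fin.cons_zero, Fin.cons_succ, h1, h2]
      rw [key]
      cases L x <;> cases ((A 0 x && A 1 x) ^^ (A 2 x && A 3 x)) <;> cases decide (∀ j : Fin s, P j x = true) <;> rfl

/-! ### The three `n = 14` instances -/

/-- **`RM(5,14)`, weight `768`** (the bent-side line `Φ = 29/32` at `n = 14`, DISPROOF.md §18.3/18.6(a): `f ⊕ g̃` of a cubic bent `g` with
quintic dual and a cubic partner `f` at `Φ = 29/32` would be such a word): a Boolean function of degree `≤ 5` on `14` bits with exactly `768`
ones is `(A₀A₁ ⊕ A₂A₃) ∧ P₀ ∧ P₁ ∧ P₂` with affine factors carrying a dual family. [this work; cite: KasamiTokura1970, Thm 1] -/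
theorem kh_structure_rm5_fourteen_768 (e : (Fin (7 + 7) → Bool) → Bool) (he : IsDegLeFun 5 e)
    (hw : #(univ.filter fun x => e x = true) = 768) :
    ∃ (A : Fin 4 → (Fin (7 + 7) → Bool) → Bool) (P : Fin 3 → (Fin (7 + 7) → Bool) → Bool)
      (v : Fin 4 → Fin (7 + 7) → Bool) (u : Fin 3 → Fin (7 + 7) → Bool) (x₀ : Fin (7 + 7) → Bool),
      (∀ i, IsDegLeFun 1 (A i)) ∧ (∀ j, IsDegLeFun 1 (P j)) ∧
      (∀ i x, A i (bxor x (v i)) = !A i x) ∧ (∀ i k x, i ≠ k → A i (bxor x (v k)) = A i x) ∧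
      (∀ i k x, A i (bxor x (u k)) = A i x) ∧
      (∀ j k x, P j (bxor x (v k)) = P j x) ∧
      (∀ j x, P j (bxor x (u j)) = !P j x) ∧ (∀ j k x, j ≠ k → P j (bxor x (u k)) = P j x) ∧
      (∀ j, P j x₀ = true) ∧
      ∀ x, e x = (((A 0 x && A 1 x) ^^ (A 2 x && A 3 x)) && decide (∀ j, P j x = true)) :=
  kh_structure 3 (7 + 7) e he (by rw [hw]; norm_num)

/-- **`RM(4,14)`, weight `1536`** (configuration T′ of the type-O boundary at `n = 14`, DISPROOF.md §32.5: the base set `E = {d₁ = d₂}` of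
a type-O side at `Φ = 121/128` has degree `≤ 4` and exactly `1536` points): such a set is `{A₀A₁ ⊕ A₂A₃ = 1} ∩ {P₀ = P₁ = 1}` with affine
factors carrying a dual family. [this work; cite: KasamiTokura1970, Thm 1] -/
theorem kh_structure_rm4_fourteen_1536 (e : (Fin (7 + 7) → Bool) → Bool) (he : IsDegLeFun 4 e)
    (hw : #(univ.filter fun x => e x = true) = 1536) :
    ∃ (A : Fin 4 → (Fin (7 + 7) → Bool) → Bool) (P : Fin 2 → (Fin (7 + 7) → Bool) → Bool)
      (v : Fin 4 → Fin (7 + 7) → Bool) (u : Fin 2 → Fin (7 + 7) → Bool) (x₀ : Fin (7 + 7) → Bool),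
      (∀ i, IsDegLeFun 1 (A i)) ∧ (∀ j, IsDegLeFun 1 (P j)) ∧
      (∀ i x, A i (bxor x (v i)) = !A i x) ∧ (∀ i k x, i ≠ k → A i (bxor x (v k)) = A i x) ∧
      (∀ i k x, A i (bxor x (u k)) = A i x) ∧
      (∀ j k x, P j (bxor x (v k)) = P j x) ∧
      (∀ j x, P j (bxor x (u j)) = !P j x) ∧ (∀ j k x, j ≠ k → P j (bxor x (u k)) = P j x) ∧
      (∀ j, P j x₀ = true) ∧
      ∀ x, e x = (((A 0 x && A 1 x) ^^ (A 2 x && A 3 x)) && decide (∀ j, P j x = true)) :=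
  kh_structure 2 (7 + 7) e he (by rw [hw]; norm_num)

/-- **`RM(2,14)`, weight `6144`** (branch (L′b) of the level-`6 × 6` configuration at `n = 14`, DISPROOF.md §32.4: the odd set `P = {u′ odd}`
of a level-6 side is the support of a quadratic, of size `6144 = 1.5·2¹²` in that branch): such a quadratic is `A₀A₁ ⊕ A₂A₃` with affine
factors carrying a dual family. [this work; cite: MacWilliamsSloane1977, Ch. 15 §2 Thm 4–5] -/
theorem kh_structure_rm2_fourteen_6144 (q : (Fin (7 + 7) → Bool) → Bool) (hq : IsDegLeFun 2 q)
    (hw : #(univ.filter fun x => q x = true) = 6144) :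
    ∃ (A : Fin 4 → (Fin (7 + 7) → Bool) → Bool) (v : Fin 4 → Fin (7 + 7) → Bool),
      (∀ i, IsDegLeFun 1 (A i)) ∧ (∀ i x, A i (bxor x (v i)) = !A i x) ∧
      (∀ i k x, i ≠ k → A i (bxor x (v k)) = A i x) ∧
      ∀ x, q x = ((A 0 x && A 1 x) ^^ (A 2 x && A 3 x)) :=
  kh_base q hq (by rw [hw]; norm_num)

end Summit.QuantumAdvantage.QuantumAdvantage.Theorems.CubicForrelation.NearExactIsExact

end
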